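import Mathlib
import Literature.Geometry.Lorentzian.KerrSchildCoord
import Literature.Geometry.Lorentzian.KerrConvergence
import Summits.FinalStateConjecture.FinalStateConjecture.Theorems.EIHFluxBalanceInertialRecessionLorentz

/-!
# Route ClusterCompleteness — `RecedingDopplerBudget`: geometry of the receding near zones

Helper file for the support item `stmt-FinalStateConjecture-15025`
(`Summit.FinalStateConjecture.FinalStateConjecture.Theses.ClusterCompleteness.RecedingDopplerBudget`).

Elementary Minkowski geometry of the item's configuration — `N` inertial holes with 4-velocities
`uᵢ = Λᵢ e₀` (`‖uᵢ~‖ ≤ uᵢ⁰/10`), lab positions `pᵢ` at lab time `0`, separations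
`dist(pᵢ, pⱼ) ≥ 1000(Mᵢ + Mⱼ)` and pairwise strict recession `⟪pᵢ − pⱼ, vᵢ − vⱼ⟫ > 0`
(`vᵢ = uᵢ~/uᵢ⁰`), with the constants `v₀ = α = 1/10`, `d₀ = 1000` chosen in the proof:

* Lorentz-factor bookkeeping: `1 ≤ uᵢ⁰ ≤ 51/50`, `‖uᵢ‖ ≤ 2`, `‖Λᵢ‖ ≤ 5` (`u_zero_le`, `norm_u_le`,
  `norm_lorentz_le_five`), and `η(u, w) = −u⁰w⁰ + ⟪u~, w~⟫`;
* the rest-frame decomposition `x = (0, p_k) + (q_k x)⁰ u_k + Λ_k (q_k x)~` (`eq_decomp`) with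
  `‖(q_k x)~‖ ≤ 17M_k` on the closed zone `{r_k(q_k x) ≤ 16M_k}` (`norm_spatialPart_le`), whence
  **every closed zone lies in the lab ball of radius `100M_k` about the moving centre
  `p_k + x⁰ v_k`** (`norm_spatial_sub_centre_le`);
* **recession keeps the centres apart**: `‖(pᵢ + t vᵢ) − (pⱼ + t vⱼ)‖ ≥ dist(pᵢ, pⱼ)` for `t ≥ 0`
  (`dist_le_norm_centre_sub`), so two closed zones never meet at lab times `≥ 0`
  (`zone_disjoint`), and two events in different zones in causal order are `≥ 800(Mⱼ + M_k)` apart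
  in lab time (`time_gap`);
* distinct 4-velocities have relative Lorentz factor `γ_rel = −η(uᵢ, uⱼ) > 1`
  (`one_lt_neg_minkowski_u`).
-/

noncomputable section

open Literature.Geometry.Lorentzian Set
open scoped InnerProductSpace

namespace Summit.FinalStateConjecture.FinalStateConjecture.Theorems.RecedingDoppler

/-! ### Lorentz-factor bookkeeping -/

/-- `η(u, w) = −u⁰ w⁰ + ⟪u~, w~⟫` (O'Neill 1983, Ch. 3, p. 55). [folklore] -/
theorem minkowski_bilin_eq_inner (z w : E4) :
    Minkowski.bilin z w = -(z 0 * w 0) + ⟪E4.spatial z, E4.spatial w⟫_ℝ := by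
  rw [Minkowski.bilin_apply]
  congr 1
  rw [show ⟪E4.spatial z, E4.spatial w⟫_ℝ =
      ∑ i : Fin 3, ⟪E4.spatial z i, E4.spatial w i⟫_ℝ from PiLp.inner_apply _ _]
  refine Finset.sum_congr rfl fun i _ ↦ ?_
  rw [E4.spatial_apply, E4.spatial_apply, real_inner_eq_re_inner]
  simp [mul_comm]

/-- `|z⁰| ≤ ‖z‖` and `‖z~‖ ≤ ‖z‖` for the Euclidean norm of `E4`. [folklore] -/
theorem abs_zero_le_norm_and (z : E4) : |z 0| ≤ ‖z‖ ∧ ‖E4.spatial z‖ ≤ ‖z‖ := by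
  have h := norm_sq_eq_sq_add_spatialNorm_sq z
  rw [E4.spatialNorm] at h
  constructor
  · refine (sq_le_sq₀ (abs_nonneg _) (norm_nonneg z)).mp ?_
    rw [sq_abs]; nlinarith [sq_nonneg ‖E4.spatial z‖]
  · refine (sq_le_sq₀ (norm_nonneg _) (norm_nonneg z)).mp ?_
    nlinarith [sq_nonneg (z 0)]

section Velocity

variable (Λk : lorentzGroup) {uk : E4}

/-- `η(u, u) = −1` for the 4-velocity `u = Λ e₀` (O'Neill 1983, Ch. 9, p. 233). [folklore] -/
theorem minkowski_u_u (hu : uk = (Λk : E4 ≃L[ℝ] E4) (E4.basisVector 0)) :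
    Minkowski.bilin uk uk = -1 := by
  rw [hu, Λk.2, Minkowski.bilin_basisVector_zero]

/-- `(u⁰)² = 1 + ‖u~‖²` for `u = Λ e₀`. [folklore] -/
theorem u_zero_sq (hu : uk = (Λk : E4 ≃L[ℝ] E4) (E4.basisVector 0)) :
    uk 0 ^ 2 = 1 + ‖E4.spatial uk‖ ^ 2 := by
  have h := lorentz_apply_zero_sq Λk
  rw [← hu, E4.spatialNorm] at h
  exact h

/-- `1 ≤ u⁰` for a future-directed 4-velocity `u = Λ e₀`. [folklore] -/
theorem one_le_u_zero (hu : uk = (Λk : E4 ≃L[ℝ] E4) (E4.basisVector 0)) (h0 : 0 < uk 0) :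
    1 ≤ uk 0 := by
  have h := u_zero_sq Λk hu
  nlinarith [sq_nonneg ‖E4.spatial uk‖]

/-- **Slow holes have Lorentz factor `≤ 51/50`**: `‖u~‖ ≤ u⁰/10` forces `(u⁰)² ≤ 100/99`.
[folklore] -/
theorem u_zero_le (hu : uk = (Λk : E4 ≃L[ℝ] E4) (E4.basisVector 0))
    (hv : 0 < uk 0 ∧ ‖E4.spatial uk‖ ≤ 1 / 10 * uk 0) : uk 0 ≤ 51 / 50 := by
  have h := u_zero_sq Λk hu
  obtain ⟨h0, hs⟩ := hv
  have h1 : ‖E4.spatial uk‖ ^ 2 ≤ (1 / 10 * uk 0) ^ 2 :=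
    pow_le_pow_left₀ (norm_nonneg _) hs 2
  nlinarith

/-- `‖u‖ ≤ 2` (Euclidean norm of `E4`) for a slow 4-velocity. [folklore] -/
theorem norm_u_le (hu : uk = (Λk : E4 ≃L[ℝ] E4) (E4.basisVector 0))
    (hv : 0 < uk 0 ∧ ‖E4.spatial uk‖ ≤ 1 / 10 * uk 0) : ‖uk‖ ≤ 2 := by
  have h := norm_sq_eq_sq_add_spatialNorm_sq uk
  rw [E4.spatialNorm] at h
  have h1 := u_zero_le Λk hu hv
  have h2 := u_zero_sq Λk hu
  have h3 : ‖uk‖ ^ 2 ≤ 2 ^ 2 := by nlinarith [hv.1]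
  exact (sq_le_sq₀ (norm_nonneg _) (by norm_num)).mp h3

/-- `‖Λ‖ ≤ 5` (Euclidean operator norm) for the Lorentz motion of a slow hole
(`norm_lorentz_le`: `‖Λ‖ ≤ 1 + 3(Λe₀)⁰`). [folklore] -/
theorem norm_lorentz_le_five (hu : uk = (Λk : E4 ≃L[ℝ] E4) (E4.basisVector 0))
    (hv : 0 < uk 0 ∧ ‖E4.spatial uk‖ ≤ 1 / 10 * uk 0) :
    ‖((Λk : E4 ≃L[ℝ] E4) : E4 →L[ℝ] E4)‖ ≤ 5 := by
  have h := norm_lorentz_le Λk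
  rw [← hu, abs_of_pos hv.1] at h
  have h1 := u_zero_le Λk hu hv
  linarith

end Velocity

/-! ### Rest-frame decomposition; closed zones lie in lab balls about the moving centres -/

section Decomp

variable {Mk ak : ℝ} (Λk : lorentzGroup) (pk : E3) {uk : E4} {qk : E4 → E4}

/-- **Rest-frame decomposition of an event**: `x = (0, p) + (q x)⁰ u + Λ (q x)~` where
`q x = Λ⁻¹(x − (0, p))`, `u = Λ e₀`, and `(q x)~ = q x − (q x)⁰ e₀` is the spatial part of the
rest-frame position (O'Neill 1983, Ch. 9, p. 236). [folklore] -/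
theorem eq_decomp (hu : uk = (Λk : E4 ≃L[ℝ] E4) (E4.basisVector 0))
    (hq : ∀ x, qk x = poincareInv Λk (E4.ofTimeSpace 0 pk) x) (x : E4) :
    x = E4.ofTimeSpace 0 pk + (qk x) 0 • uk +
      (Λk : E4 ≃L[ℝ] E4) (qk x - (qk x) 0 • E4.basisVector 0) := by
  have h1 : (Λk : E4 ≃L[ℝ] E4) (qk x) = x - E4.ofTimeSpace 0 pk := by
    rw [hq, poincareInv, ContinuousLinearEquiv.apply_symm_apply]
  rw [map_sub, map_smul, ← hu, h1]
  abel

/-- On the closed zone `{r(q x) ≤ 16M}` (with `|a| ≤ M/10`) the rest-frame spatial position has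
norm `≤ 17M`: `‖y~‖² − a² ≤ r(y)²` (`Kerr.spatialNorm_sq_sub_sq_le_radius_sq`). [folklore] -/
theorem norm_spatialPart_le (hM : 0 < Mk) (ha : |ak| ≤ 1 / 10 * Mk) {y : E4}
    (hy : Kerr.radius ak y ≤ 16 * Mk) : ‖y - y 0 • E4.basisVector 0‖ ≤ 17 * Mk := by
  have h0 : (y - y 0 • E4.basisVector 0) 0 = 0 := by simp
  have h1 : ‖y - y 0 • E4.basisVector 0‖ = E4.spatialNorm y := by
    rw [norm_eq_spatialNorm_of_apply_zero_eq_zero h0, E4.spatialNorm, E4.spatialNorm, map_sub,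
      map_smul]
    have : E4.spatial (E4.basisVector 0) = 0 := by
      ext i; simp [E4.spatial_apply, Fin.succ_ne_zero]
    rw [this, smul_zero, sub_zero]
  rw [h1]
  have h2 := Kerr.spatialNorm_sq_sub_sq_le_radius_sq ak y
  have h3 : Kerr.radius ak y ^ 2 ≤ (16 * Mk) ^ 2 :=
    pow_le_pow_left₀ (Kerr.radius_nonneg _ _) hy 2
  have h4 : ak ^ 2 ≤ (1 / 10 * Mk) ^ 2 := by
    rw [← sq_abs ak]; exact pow_le_pow_left₀ (abs_nonneg _) ha 2
  have h5 : E4.spatialNorm y ^ 2 ≤ (17 * Mk) ^ 2 := by nlinarith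
  exact (sq_le_sq₀ (E4.spatialNorm_nonneg _) (by positivity)).mp h5

/-- **Every closed zone lies in the lab ball of radius `100M` about the moving centre**: if
`r(q x) ≤ 16M` then `‖x~ − (p + x⁰ v)‖ ≤ 100M`, `v = u~/u⁰` (boosts of slow holes distort the
rest-frame ball `{‖y~‖ ≤ 17M}` by at most `‖Λ‖(1 + v₀) ≤ 5.5`). [folklore] -/
theorem norm_spatial_sub_centre_le (hM : 0 < Mk) (ha : |ak| ≤ 1 / 10 * Mk)
    (hu : uk = (Λk : E4 ≃L[ℝ] E4) (E4.basisVector 0))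
    (hv : 0 < uk 0 ∧ ‖E4.spatial uk‖ ≤ 1 / 10 * uk 0)
    (hq : ∀ x, qk x = poincareInv Λk (E4.ofTimeSpace 0 pk) x) {x : E4}
    (hx : Kerr.radius ak (qk x) ≤ 16 * Mk) :
    ‖E4.spatial x - (pk + x 0 • (uk 0)⁻¹ • E4.spatial uk)‖ ≤ 100 * Mk := by
  set z : E4 := (Λk : E4 ≃L[ℝ] E4) (qk x - (qk x) 0 • E4.basisVector 0) with hz
  have hdec := eq_decomp Λk pk hu hq x
  rw [← hz] at hdec
  -- components of the decomposition
  have h0 : x 0 = (qk x) 0 * uk 0 + z 0 := by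
    have := congrArg (fun w : E4 ↦ w 0) hdec
    simpa using this
  have hsp : E4.spatial x = pk + (qk x) 0 • E4.spatial uk + E4.spatial z := by
    have := congrArg E4.spatial hdec
    rw [map_add, map_add, map_smul, E4.spatial_ofTimeSpace] at this
    exact this
  have hu0 : uk 0 ≠ 0 := hv.1.ne'
  have hkey : E4.spatial x - (pk + x 0 • (uk 0)⁻¹ • E4.spatial uk) =
      E4.spatial z - (z 0 * (uk 0)⁻¹) • E4.spatial uk := by
    rw [hsp, h0, smul_smul]
    have : (((qk x) 0 * uk 0 + z 0) * (uk 0)⁻¹) = (qk x) 0 + z 0 * (uk 0)⁻¹ := by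
      field_simp
    rw [this, add_smul]
    abel
  rw [hkey]
  -- norms
  have hzn : ‖z‖ ≤ 85 * Mk := by
    have h1 := norm_spatialPart_le hM ha hx
    have h2 := norm_lorentz_le_five Λk hu hv
    calc ‖z‖ ≤ ‖((Λk : E4 ≃L[ℝ] E4) : E4 →L[ℝ] E4)‖ * ‖qk x - (qk x) 0 • E4.basisVector 0‖ :=
          ((Λk : E4 ≃L[ℝ] E4) : E4 →L[ℝ] E4).le_opNorm _
      _ ≤ 5 * (17 * Mk) := mul_le_mul h2 h1 (norm_nonneg _) (by norm_num)
      _ = 85 * Mk := by ring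
  obtain ⟨hz0, hzs⟩ := abs_zero_le_norm_and z
  have hvn : ‖(z 0 * (uk 0)⁻¹) • E4.spatial uk‖ ≤ 1 / 10 * ‖z‖ := by
    rw [norm_smul, Real.norm_eq_abs, abs_mul, abs_inv, abs_of_pos hv.1]
    calc |z 0| * (uk 0)⁻¹ * ‖E4.spatial uk‖ ≤ |z 0| * (uk 0)⁻¹ * (1 / 10 * uk 0) := by
          gcongr
          · exact mul_nonneg (abs_nonneg _) (inv_nonneg.2 hv.1.le)
          · exact hv.2
      _ = 1 / 10 * |z 0| := by field_simp
      _ ≤ 1 / 10 * ‖z‖ := by linarith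
  calc ‖E4.spatial z - (z 0 * (uk 0)⁻¹) • E4.spatial uk‖
      ≤ ‖E4.spatial z‖ + ‖(z 0 * (uk 0)⁻¹) • E4.spatial uk‖ := norm_sub_le _ _
    _ ≤ ‖z‖ + 1 / 10 * ‖z‖ := add_le_add hzs hvn
    _ ≤ 100 * Mk := by linarith

/-- The lab time of an event in terms of its rest-frame time: `x⁰ = (q x)⁰ u⁰ + (Λ (q x)~)⁰` with
`|(Λ (q x)~)⁰| ≤ 85M` on the closed zone, so `(q x)⁰ ≥ (x⁰ − 85M)/u⁰` and `(q x)⁰ ≤ x⁰ + 85M`.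
[folklore] -/
theorem restTime_bounds (hM : 0 < Mk) (ha : |ak| ≤ 1 / 10 * Mk)
    (hu : uk = (Λk : E4 ≃L[ℝ] E4) (E4.basisVector 0))
    (hv : 0 < uk 0 ∧ ‖E4.spatial uk‖ ≤ 1 / 10 * uk 0)
    (hq : ∀ x, qk x = poincareInv Λk (E4.ofTimeSpace 0 pk) x) {x : E4}
    (hx : Kerr.radius ak (qk x) ≤ 16 * Mk) :
    x 0 = (qk x) 0 * uk 0 + ((Λk : E4 ≃L[ℝ] E4) (qk x - (qk x) 0 • E4.basisVector 0)) 0 ∧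
      |((Λk : E4 ≃L[ℝ] E4) (qk x - (qk x) 0 • E4.basisVector 0)) 0| ≤ 85 * Mk ∧
      ‖(Λk : E4 ≃L[ℝ] E4) (qk x - (qk x) 0 • E4.basisVector 0)‖ ≤ 85 * Mk := by
  set z : E4 := (Λk : E4 ≃L[ℝ] E4) (qk x - (qk x) 0 • E4.basisVector 0) with hz
  have hdec := eq_decomp Λk pk hu hq x
  rw [← hz] at hdec
  have h0 : x 0 = (qk x) 0 * uk 0 + z 0 := by
    have := congrArg (fun w : E4 ↦ w 0) hdec
    simpa using this
  have hzn : ‖z‖ ≤ 85 * Mk := by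
    have h1 := norm_spatialPart_le hM ha hx
    have h2 := norm_lorentz_le_five Λk hu hv
    calc ‖z‖ ≤ ‖((Λk : E4 ≃L[ℝ] E4) : E4 →L[ℝ] E4)‖ * ‖qk x - (qk x) 0 • E4.basisVector 0‖ :=
          ((Λk : E4 ≃L[ℝ] E4) : E4 →L[ℝ] E4).le_opNorm _
      _ ≤ 5 * (17 * Mk) := mul_le_mul h2 h1 (norm_nonneg _) (by norm_num)
      _ = 85 * Mk := by ring
  exact ⟨h0, (abs_zero_le_norm_and z).1.trans hzn, hzn⟩

end Decomp

/-! ### Recession keeps the zones apart; causal time gap between different zones -/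

section Recession

variable {N : ℕ} {M a : Fin N → ℝ} {Λ : Fin N → lorentzGroup} {p : Fin N → E3} {u : Fin N → E4}
  {q : Fin N → E4 → E4}

/-- **Strict recession makes the lab separation of the centres nondecreasing**: for `t ≥ 0`,
`‖(pᵢ + t vᵢ) − (pⱼ + t vⱼ)‖ ≥ dist(pᵢ, pⱼ)` when `⟪pᵢ − pⱼ, vᵢ − vⱼ⟫ > 0`. [folklore] -/
theorem dist_le_norm_centre_sub {pi pj vi vj : E3} (hrec : 0 < ⟪pi - pj, vi - vj⟫_ℝ) {t : ℝ}
    (ht : 0 ≤ t) : dist pi pj ≤ ‖(pi + t • vi) - (pj + t • vj)‖ := by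
  rw [dist_eq_norm]
  have h1 : (pi + t • vi) - (pj + t • vj) = (pi - pj) + t • (vi - vj) := by
    rw [smul_sub]; abel
  rw [h1]
  refine (sq_le_sq₀ (norm_nonneg _) (norm_nonneg _)).mp ?_
  rw [norm_add_sq_real, norm_smul, real_inner_smul_right, Real.norm_eq_abs, abs_of_nonneg ht]
  nlinarith [sq_nonneg (t * ‖vi - vj‖), mul_nonneg ht hrec.le]

/-- **Two closed zones never meet at lab times `≥ 0`**: an event with `x⁰ ≥ 0` in the closed
zones of two distinct holes would put the two moving centres within `100Mᵢ + 100Mⱼ`, against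
their separation `≥ 1000(Mᵢ + Mⱼ)`. [folklore] -/
theorem zone_disjoint (hM : ∀ i, 0 < M i) (ha : ∀ i, |a i| ≤ 1 / 10 * M i)
    (hu : ∀ i, u i = (Λ i : E4 ≃L[ℝ] E4) (E4.basisVector 0))
    (hv : ∀ i, 0 < u i 0 ∧ ‖E4.spatial (u i)‖ ≤ 1 / 10 * u i 0)
    (hq : ∀ i x, q i x = poincareInv (Λ i) (E4.ofTimeSpace 0 (p i)) x)
    (hsep : ∀ i j, i ≠ j → 1000 * (M i + M j) ≤ dist (p i) (p j) ∧
      0 < ⟪p i - p j, (u i 0)⁻¹ • E4.spatial (u i) - (u j 0)⁻¹ • E4.spatial (u j)⟫_ℝ)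
    {x : E4} (hx0 : 0 ≤ x 0) {i j : Fin N}
    (hi : Kerr.radius (a i) (q i x) ≤ 16 * M i) (hj : Kerr.radius (a j) (q j x) ≤ 16 * M j) :
    i = j := by
  by_contra hij
  have h1 := norm_spatial_sub_centre_le (Λ i) (p i) (hM i) (ha i) (hu i) (hv i) (hq i) hi
  have h2 := norm_spatial_sub_centre_le (Λ j) (p j) (hM j) (ha j) (hu j) (hv j) (hq j) hj
  obtain ⟨hd, hrec⟩ := hsep i j hij
  have h3 := dist_le_norm_centre_sub hrec hx0
  have h4 : ‖(p i + x 0 • (u i 0)⁻¹ • E4.spatial (u i)) - (p j + x 0 • (u j 0)⁻¹ • E4.spatial (u j))‖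
      ≤ 100 * M i + 100 * M j := by
    have := norm_sub_le
      ((p i + x 0 • (u i 0)⁻¹ • E4.spatial (u i)) - E4.spatial x)
      ((p j + x 0 • (u j 0)⁻¹ • E4.spatial (u j)) - E4.spatial x)
    rw [sub_sub_sub_cancel_right] at this
    rw [norm_sub_rev] at h1 h2
    linarith
  have hMi := hM i
  have hMj := hM j
  linarith

/-- **Causal time gap between different zones**: if `x` lies in the closed zone of hole `k` at a
lab time `x⁰ ≥ 0`, `y` lies in the closed zone of hole `j ≠ k`, and `y` is causally after `x` in
the lab (`y⁰ − x⁰ ≥ ‖y~ − x~‖`), then `y⁰ − x⁰ ≥ 800(Mⱼ + M_k)` — a signal must cross the gap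
between the receding balls, whose own drift is at most `v₀ = 1/10`. [folklore] -/
theorem time_gap (hM : ∀ i, 0 < M i) (ha : ∀ i, |a i| ≤ 1 / 10 * M i)
    (hu : ∀ i, u i = (Λ i : E4 ≃L[ℝ] E4) (E4.basisVector 0))
    (hv : ∀ i, 0 < u i 0 ∧ ‖E4.spatial (u i)‖ ≤ 1 / 10 * u i 0)
    (hq : ∀ i x, q i x = poincareInv (Λ i) (E4.ofTimeSpace 0 (p i)) x)
    (hsep : ∀ i j, i ≠ j → 1000 * (M i + M j) ≤ dist (p i) (p j) ∧
      0 < ⟪p i - p j, (u i 0)⁻¹ • E4.spatial (u i) - (u j 0)⁻¹ • E4.spatial (u j)⟫_ℝ)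
    {x y : E4} (hx0 : 0 ≤ x 0) (hcausal : ‖E4.spatial y - E4.spatial x‖ ≤ y 0 - x 0)
    {k j : Fin N} (hjk : j ≠ k)
    (hxk : Kerr.radius (a k) (q k x) ≤ 16 * M k) (hyj : Kerr.radius (a j) (q j y) ≤ 16 * M j) :
    800 * (M j + M k) ≤ y 0 - x 0 := by
  have hy0 : 0 ≤ y 0 := by linarith [norm_nonneg (E4.spatial y - E4.spatial x)]
  have h1 := norm_spatial_sub_centre_le (Λ k) (p k) (hM k) (ha k) (hu k) (hv k) (hq k) hxk
  have h2 := norm_spatial_sub_centre_le (Λ j) (p j) (hM j) (ha j) (hu j) (hv j) (hq j) hyj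
  obtain ⟨hd, hrec⟩ := hsep j k hjk
  have h3 := dist_le_norm_centre_sub hrec hy0
  -- drift of centre `k` between the two lab times
  set vk : E3 := (u k 0)⁻¹ • E4.spatial (u k) with hvk
  set vj : E3 := (u j 0)⁻¹ • E4.spatial (u j) with hvj
  have hvkn : ‖vk‖ ≤ 1 / 10 := by
    rw [hvk, norm_smul, Real.norm_eq_abs, abs_inv, abs_of_pos (hv k).1]
    rw [inv_mul_le_iff₀ (hv k).1]
    linarith [(hv k).2]
  have hdrift : ‖(y 0 - x 0) • vk‖ ≤ 1 / 10 * (y 0 - x 0) := by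
    rw [norm_smul, Real.norm_eq_abs, abs_of_nonneg (by linarith [norm_nonneg (E4.spatial y - E4.spatial x)])]
    nlinarith [norm_nonneg (E4.spatial y - E4.spatial x)]
  -- triangle inequality: gap ≤ ‖y~ − x~‖ + 100Mⱼ + 100M_k + drift
  have hkey : (p j + y 0 • vj) - (p k + y 0 • vk) =
      ((p j + y 0 • vj) - E4.spatial y) + (E4.spatial y - E4.spatial x) +
        (E4.spatial x - (p k + x 0 • vk)) - (y 0 - x 0) • vk := by
    rw [sub_smul]; abel
  have h4 : ‖(p j + y 0 • vj) - (p k + y 0 • vk)‖ ≤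
      100 * M j + ‖E4.spatial y - E4.spatial x‖ + 100 * M k + 1 / 10 * (y 0 - x 0) := by
    rw [hkey]
    refine (norm_sub_le _ _).trans ?_
    refine add_le_add ((norm_add_le _ _).trans (add_le_add ((norm_add_le _ _).trans
      (add_le_add ?_ le_rfl)) ?_)) hdrift
    · rw [norm_sub_rev]; exact h2
    · exact h1
  have hMj := hM j
  have hMk := hM k
  linarith

/-- **Distinct slow 4-velocities have relative Lorentz factor `> 1`**: for `uᵢ = Λᵢe₀`,
`uⱼ = Λⱼe₀` with `‖u~‖ ≤ u⁰/10` and distinct lab velocities, `−η(uᵢ, uⱼ) > 1`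
(`2(−η(uᵢ,uⱼ) − 1) = η(uᵢ − uⱼ, uᵢ − uⱼ) = ‖uᵢ~ − uⱼ~‖² − (uᵢ⁰ − uⱼ⁰)² > 0`, the difference
of two future unit timelike vectors being spacelike; O'Neill 1983, Ch. 5, Prop. 5.30). [folklore] -/
theorem one_lt_neg_minkowski_u (Λi Λj : lorentzGroup) {ui uj : E4}
    (hui : ui = (Λi : E4 ≃L[ℝ] E4) (E4.basisVector 0))
    (huj : uj = (Λj : E4 ≃L[ℝ] E4) (E4.basisVector 0))
    (hvi : 0 < ui 0 ∧ ‖E4.spatial ui‖ ≤ 1 / 10 * ui 0)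
    (hvj : 0 < uj 0 ∧ ‖E4.spatial uj‖ ≤ 1 / 10 * uj 0)
    (hne : (ui 0)⁻¹ • E4.spatial ui ≠ (uj 0)⁻¹ • E4.spatial uj) :
    1 < -Minkowski.bilin ui uj := by
  rw [minkowski_bilin_eq_inner]
  set A := ui 0 with hA
  set B := uj 0 with hB
  set s := E4.spatial ui with hs
  set t := E4.spatial uj with ht
  have hA2 : A ^ 2 = 1 + ‖s‖ ^ 2 := u_zero_sq Λi hui
  have hB2 : B ^ 2 = 1 + ‖t‖ ^ 2 := u_zero_sq Λj huj
  obtain ⟨hA0, hsA⟩ := hvi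
  obtain ⟨hB0, htB⟩ := hvj
  -- `s ≠ t`
  have hst : s ≠ t := by
    intro hst
    apply hne
    have hAB : A = B := by
      have : A ^ 2 = B ^ 2 := by rw [hA2, hB2, hst]
      nlinarith
    rw [hAB, hst]
  have hpos : 0 < ‖s - t‖ := norm_pos_iff.2 (sub_ne_zero.2 hst)
  -- `‖s − t‖² = ‖s‖² − 2⟪s,t⟫ + ‖t‖²`
  have hexp : ‖s - t‖ ^ 2 = ‖s‖ ^ 2 - 2 * ⟪s, t⟫_ℝ + ‖t‖ ^ 2 := norm_sub_sq_real s t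
  -- `|A − B| (A + B) = |‖s‖² − ‖t‖²| ≤ (‖s‖ + ‖t‖) ‖s − t‖ ≤ (A + B)/10 ‖s − t‖`
  have hdiff : |A - B| ≤ 1 / 10 * ‖s - t‖ := by
    have h1 : (A - B) * (A + B) = ‖s‖ ^ 2 - ‖t‖ ^ 2 := by nlinarith
    have h2 : |‖s‖ - ‖t‖| ≤ ‖s - t‖ := abs_norm_sub_norm_le s t
    have h3 : |‖s‖ ^ 2 - ‖t‖ ^ 2| ≤ (‖s‖ + ‖t‖) * ‖s - t‖ := by
      rw [show ‖s‖ ^ 2 - ‖t‖ ^ 2 = (‖s‖ + ‖t‖) * (‖s‖ - ‖t‖) by ring, abs_mul,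
        abs_of_nonneg (by positivity)]
      exact mul_le_mul_of_nonneg_left h2 (by positivity)
    have h4 : |A - B| * (A + B) ≤ 1 / 10 * (A + B) * ‖s - t‖ := by
      rw [← abs_of_pos (by linarith : 0 < A + B), ← abs_mul, h1]
      refine h3.trans ?_
      rw [abs_of_pos (by linarith : 0 < A + B)]
      exact mul_le_mul_of_nonneg_right (by linarith) (norm_nonneg _)
    have hABpos : 0 < A + B := by linarith
    nlinarith [abs_nonneg (A - B)]
  have hsq : (A - B) ^ 2 ≤ (1 / 10 * ‖s - t‖) ^ 2 := by
    rw [← sq_abs (A - B)]; exact pow_le_pow_left₀ (abs_nonneg _) hdiff 2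
  -- conclude: `2(−(−AB + ⟪s,t⟫) − 1) = ‖s − t‖² − (A − B)² ≥ (99/100)‖s − t‖² > 0`
  nlinarith [hsq, hexp, hA2, hB2, hpos]

end Recession

end Summit.FinalStateConjecture.FinalStateConjecture.Theorems.RecedingDoppler

end
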